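import Summits.HodgeConjecture.HodgeConjecture.Theorems.F0P3cStCharTSEllCartanCompact   -- ★ `isCompact_centralizer_iff_not_mem_hyperbolicSet`; brings `Gqs`, `hyperbolicSet`, the CM one-place kit
import Summits.HodgeConjecture.HodgeConjecture.Theorems.F0P3cStCharTSCasselmanCap      -- ★ `integral_indicator_mul_eq_of_eqOn`
import Literature.NumberTheory.Rogawski1990.LocalTransferGlueCM                       -- ★ `totallyDisconnectedSpace_cmDatum_local`, `nonarchimedeanGroup_cmLocal` (instances at `U(Φ₃)(L⁺_v)`)
import Literature.NumberTheory.Rogawski1990.Ch12Sec5Defs                              -- ★ carpet: `EllipticData`, `IsPseudoCoeff`, `orbInt`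
import Literature.NumberTheory.Automorphic.SmoothCharacterOfCharacter                 -- ★ `SmoothIrrep.ofChar`, `IrrClass.smoothTrace_mk_ofChar`, `charDist`
import Literature.NumberTheory.Automorphic.SmoothCharacterTwist                       -- ★ p852969 TRACE-TWIST: `isLocallyConstant_character`
import Literature.Topology.LocallyConstantExtend                                      -- ★ `exists_isCompact_isOpen_mem_subset`
import Summits.HodgeConjecture.HodgeConjecture.Theorems.F0P3cStCharTSProp1261aOfNorms -- ★ 61A-OF-NORMS `innerG_self_eq_of_eq_neg_on_ellG` (brings ★ `EllLin`)
import Summits.HodgeConjecture.HodgeConjecture.Theorems.F0P3cStCharTSParField         -- ★ `isCompact_center_Gqs`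
import HarnessLib

/-!
# F0 · P3c · line LH6 «StCharTS» — CENSUS «EP-G» (G5) «DET-CHAR + PC-ST»: the CHARACTER MULTIPLES `conj(ψ∘det)·f_EP^G` and `−conj(ψ∘det)·f_EP^G`
# of Kottwitz's Euler–Poincaré function are PSEUDO-COEFFICIENTS of `ψ∘det_G` and of `St_G(ψ)`; POS-ONE at `St_G(ψ)` [Rogawski1990 §12.6 p. 187; Kottwitz1988 §2]

Cell `pub/hodgecm-mathlib` (D-0151), FLOOR 0, crux item H413 = `stmt-HodgeConjecture-24833` (`--supports` lane, helper; seat F0P3-p02 (g25), PRE-DEALT BY NAME by the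
G-row dealer F0P3a-p09 (g13) 2026-09-02T23:21:40Z; LEAD F0P3a-plan (g16) T15-05 (w2) «(G5) = GO-LOW at (G3) ∧ (G4) ★ as the Theorems-side twin of E2-5b ★ p852902»).
THEOREMS ONLY (no `def`, no instance, no notation, no named fact, no `sorry`); the §12.5 datum `𝔇` is a BINDER; the Euler–Poincaré function `fG` of ★-to-be (G3)
`F0P3cStCharTSEPGlueG.exists_epFunction_G` enters BY SHAPE (its clauses as hypotheses ∕ as one `∃`), so this file does not import (G3).
HONEST LABEL: count-neutral (the EP-G column shrinks the `St_G(ψ)`∕`ψ∘det_G` instances of the (S-𝔑) letters K1 `PseudoCoeffExists` and POS-ONE only through RIDER 2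
«EP-SPLIT», priced when the G column is ★ end to end — LEAD T15-05); h413 OPEN; HC_CM is proved only modulo the 7 printed citations (2 remaining named inputs hLiu418 =
stmt-HodgeConjecture-24832, h413 = stmt-HodgeConjecture-24833) until rung 0 closes.

THE MATHEMATICS [Rogawski1990 §12.6 p. 187 «The existence of pseudo-coefficients follows from [K], Theorem 4.1» — here, for the two members of the kind-2 pair
`{ψ∘det_G, St_G(ψ)}` [§12.2 (1) p. 173], WITHOUT [K]: Kottwitz1988 §2 Thm. 2].  Let `fG` be Kottwitz's Euler–Poincaré function on `G = U(Φ₃)(L⁺_v)` (`v` non-split): locally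
constant, compactly supported, with canonical orbital integral `1` at every regular class with COMPACT centraliser and `0` at every regular class with NON-compact centraliser,
and `fG(1)` a NEGATIVE real ((G3) ∕ (G7)).  At a §12.5 datum `𝔇` with the rung-0 pins `hμG`, `horb`, `hreg`, `hE` (`G^e` = regular elements off ★ `hyperbolicSet`, i.e. —
★ `isCompact_centralizer_iff_not_mem_hyperbolicSet` — regular with compact centraliser) and (M1∀) `hM1`, and the DET pin `𝔇.detG ψ = ⟦ψ ∘ det_Z⟧` of ★ ST-PIN
`exists_stDetFields` (conjunct `detG ψ = IrrClass.mk (SmoothIrrep.ofChar (ψ.comp detZ) _)`):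
* (M1∀) + the DET pin READ the character: `χ_{ψ∘det_G}(γ) = ψ(det_Z γ)` at every regular `γ` (§2: `Tr ⟦ξ⟧(𝟙_U) = ν(U)·χ(γ) = ν(U)·ξ(γ)` on a small compact-open `U ∋ γ`);
* `ψ(det_Z ·)` is a CLASS FUNCTION (the centre is commutative), so `Φ(γ, conj(ψ∘det_Z)·fG) = conj ψ(det_Z γ) · Φ(γ, fG)` (§1) — hence `f_det := conj(ψ∘det_Z)·fG` has
  `Φ(γ, f_det) = 0` off `G^e` and `= conj χ_{ψ∘det_G}(γ)` on `G^e`: a PSEUDO-COEFFICIENT of `ψ∘det_G` (§3);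
* with «`χ_{St_G(ψ)} = −χ_{ψ∘det_G}` on `G^e`» (the conclusion of ★ OPP-23 `F0P3cStCharTSOpp23.charOpposite_of_PS2` at the kind-2 pair, taken as the binder `hOpp` — the rung-0 pen
  discharges it with ★ OPP-23 + the (DET)(ST-L2) sockets), `f_St := −f_det` is a PSEUDO-COEFFICIENT of `St_G(ψ)` (§4), and `f_St(1) = −fG(1)` is a POSITIVE real (§5: POS-ONE at
  `St_G(ψ)`; print p. 194 «`f_π(1) = d(π)`», p. 195 «formal degrees are positive» — here Serre's sign of the Euler–Poincaré measure, ★ (G7)).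
* FILE B `F0P3cStCharTSEPPseudoCoeffStLetters` packages the K1 instances and POS-ONE-St over ONE existential `hEP` = the conclusion of (G3) `exists_epFunction_G` VERBATIM, and adds K2′ at `St_G(ψ)`.

* §1 `classOrbitalIntegral_mul_of_forall_conj_eq` (class functions factor out of orbital integrals), `conj_centerChar_detZ_conj_eq` (`ψ ∘ det_Z` is a class function).
* §2 **`char_detG_eq_of_pin`** — `∀ γ ∈ G^r, χ_{𝔇.detG ψ}(γ) = ψ(det_Z γ)`.
* §3 **`isPseudoCoeff_detG_of_ep`** · §4 **`isPseudoCoeff_stG_of_ep`** · §5 `epDet_apply_one`, `epSt_apply_one`, **`epSt_one_re_pos_im_zero`**.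
* §1 also `norm_centerChar_eq_one` (continuous characters of compact groups are unitary), §1b `innerG_self_eq_ellipticWeylMass_of_mul_conj_eq_one` (for FILE B's K2′).

## References
* [Rogawski1990] J. D. Rogawski, *Automorphic Representations of Unitary Groups in Three Variables*, Ann. of Math. Stud. 123 (1990): §12.2 (1) p. 173 (the pair `{ψ∘det, St(ψ)}`),
  §12.5 p. 184 (`G^e`), §12.6 p. 187 (pseudo-coefficients), Prop. 12.6.1 p. 188, pp. 194–195 (`f_π(1) = d(π) > 0`), §4.9 p. 54 (orbital integrals).
* [Kottwitz1988] R. E. Kottwitz, *Tamagawa numbers*, Ann. of Math. 127 (1988), §2 Theorem 2 (Euler–Poincaré functions: `Φ(γ, f_EP) = χ(𝒯^γ)`).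
* [Serre1971] J.-P. Serre, *Cohomologie des groupes discrets*, Ann. of Math. Stud. 70 (1971), §3.3 (sign of the Euler–Poincaré measure).
-/

set_option autoImplicit false
-- the mandated namespace has the single-problem summit's repeated segment (`HodgeConjecture.HodgeConjecture`)
set_option linter.dupNamespace false

noncomputable section

open NumberField IsDedekindDomain MeasureTheory MeasureTheory.Measure Filter Topology Set
open scoped Matrix MatrixGroups ComplexConjugate
open Literature.NumberTheory.Rogawski1990 Literature.NumberTheory.Rogawski1990.Ch12Sec5
open Literature.NumberTheory.Automorphic Literature.NumberTheory.Automorphic.UnitaryGroup Literature.MeasureTheory.Group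

namespace Summit.HodgeConjecture.HodgeConjecture.Cruxes.H413.F0P3cStCharTSEPPseudoCoeffSt

open Summit.HodgeConjecture.HodgeConjecture.Cruxes.H413
open Summit.HodgeConjecture.HodgeConjecture.Cruxes.H413.F0P3cStCharTSTorusDefs

/-! ## §1 Plumbing: class functions factor out of orbital integrals; `ψ ∘ det_Z` is a class function -/

section Plumbing

variable {G : Type*} [Group G] [∀ γ : G, MeasurableSpace (G ⧸ Subgroup.centralizer ({γ} : Set G))]

/-- **A class function factors out of an orbital integral**: if `c (x g x⁻¹) = c g` for all `x, g` then `Φ(⟦γ⟧, c · f) = c(γ) · Φ(⟦γ⟧, f)` for every orbital measure family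
(the orbital integrand at the representative `γ_c` is `c(y γ_c y⁻¹) f(y γ_c y⁻¹) = c(γ) f(y γ_c y⁻¹)`; no integrability needed). [cite: Rogawski1990, §4.9 p. 54] -/
theorem classOrbitalIntegral_mul_of_forall_conj_eq (m : OrbitalMeasureFamily G) (c f : G → ℂ) (hc : ∀ x g : G, c (x * g * x⁻¹) = c g) (γ : G) :
    classOrbitalIntegral m (fun x => c x * f x) (ConjClasses.mk γ) = c γ * classOrbitalIntegral m f (ConjClasses.mk γ) := by
  -- the representative `γ_c = out ⟦γ⟧` is conjugate to `γ`
  have hrep : c (Quotient.out (ConjClasses.mk γ) : G) = c γ := by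
    have hmk : ConjClasses.mk (Quotient.out (ConjClasses.mk γ) : G) = ConjClasses.mk γ := Quotient.out_eq _
    obtain ⟨d, hd⟩ := isConj_iff.1 (ConjClasses.mk_eq_mk_iff_isConj.1 hmk)
    calc c (Quotient.out (ConjClasses.mk γ) : G) = c (d * (Quotient.out (ConjClasses.mk γ) : G) * d⁻¹) := (hc d _).symm
      _ = c γ := by rw [hd]
  rw [classOrbitalIntegral_eq, classOrbitalIntegral_eq, orbitalIntegral_eq_integral_descConj, orbitalIntegral_eq_integral_descConj,
    ← integral_const_mul]
  refine integral_congr_ae (Eventually.of_forall fun y => ?_)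
  induction y using QuotientGroup.induction_on with
  | H x =>
    show c (x * _ * x⁻¹) * f (x * _ * x⁻¹) = c γ * f (x * _ * x⁻¹)
    rw [hc, hrep]

omit [∀ γ : G, MeasurableSpace (G ⧸ Subgroup.centralizer ({γ} : Set G))] in
/-- **`g ↦ ψ(det_Z g)` is a CLASS FUNCTION** for any hom `detZ : G →* Z(G)` into the (commutative) centre and any `ψ : Z(G) →* ℂˣ`, and so is its conjugate.
[cite: Rogawski1990, §12.2 (1) p. 173] -/
theorem conj_centerChar_detZ_conj_eq (detZ : G →* ↥(Subgroup.center G)) (ψ : ↥(Subgroup.center G) →* ℂˣ) (x g : G) :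
    conj ((ψ (detZ (x * g * x⁻¹)) : ℂˣ) : ℂ) = conj (((ψ (detZ g)) : ℂˣ) : ℂ) := by
  have h : detZ (x * g * x⁻¹) = detZ g := by
    apply Subtype.ext
    rw [map_mul, map_mul, map_inv, Subgroup.coe_mul, Subgroup.coe_mul, Subgroup.coe_inv,
      Subgroup.mem_center_iff.1 (detZ g).2 (detZ x : G), mul_inv_cancel_right]
  rw [h]

omit [∀ γ : G, MeasurableSpace (G ⧸ Subgroup.centralizer ({γ} : Set G))] in
/-- **A continuous character of a COMPACT group is unitary**: `‖ψ z‖ = 1` for `ψ : Z →* ℂˣ` continuous (as a `ℂ`-valued map) on a compact group `Z` — the image is bounded,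
and `‖ψ w‖ > 1` would make `‖ψ(wⁿ)‖` unbounded (applied to `w = z` and `w = z⁻¹`; the `Circle` case is ★ `CircleCharacterClassification.norm_map_eq_one`).
[cite: Rogawski1990, §12.2 (1) p. 173] -/
theorem norm_centerChar_eq_one {Z : Type*} [Group Z] [TopologicalSpace Z] [CompactSpace Z] [ContinuousMul Z] (ψ : Z →* ℂˣ)
    (hψ : Continuous fun z : Z => ((ψ z : ℂˣ) : ℂ)) (z : Z) : ‖((ψ z : ℂˣ) : ℂ)‖ = 1 := by
  obtain ⟨R, hR⟩ := Bornology.IsBounded.exists_norm_le (isCompact_range hψ).isBounded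
  have hbd : ∀ w : Z, ‖((ψ w : ℂˣ) : ℂ)‖ ≤ R := fun w => hR _ ⟨w, rfl⟩
  have hle : ∀ w : Z, ‖((ψ w : ℂˣ) : ℂ)‖ ≤ 1 := by
    intro w
    by_contra hw
    rw [not_le] at hw
    obtain ⟨n, hn⟩ := pow_unbounded_of_one_lt R hw
    have hwn := hbd (w ^ n)
    rw [map_pow, Units.val_pow_eq_pow_val, norm_pow] at hwn
    exact absurd (lt_of_lt_of_le hn hwn) (lt_irrefl _)
  refine le_antisymm (hle z) ?_
  have hz' := hle z⁻¹
  rw [map_inv, Units.val_inv_eq_inv_val, norm_inv] at hz'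
  have hpos : 0 < ‖((ψ z : ℂˣ) : ℂ)‖ := norm_pos_iff.2 (Units.ne_zero _)
  exact (inv_le_one₀ hpos).1 hz'

end Plumbing

/-! ## §1b `⟨α, α⟩_e` is the elliptic Weyl mass when `|α| = 1` a.e. on the elliptic tori -/

section GenericDatum

variable {G H : Type} [Group G] [TopologicalSpace G] [IsTopologicalGroup G] [MeasurableSpace G]
  [∀ γ : G, MeasurableSpace (G ⧸ Subgroup.centralizer ({γ} : Set G))] [MeasurableSpace (G ⧸ Subgroup.center G)]
  [Group H] [TopologicalSpace H] [IsTopologicalGroup H] [MeasurableSpace H] (𝔇 : EllipticData G H)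

/-- **`⟨α, α⟩_e = Σ_T |Ω_T|⁻¹ ∫_T D_G²`** (the elliptic Weyl mass of `G`) whenever `α · conj α = 1` almost everywhere on every elliptic Cartan representative — the case of a UNITARY
character `α = ψ∘det`. [cite: Rogawski1990, §12.5 p. 184] -/
theorem innerG_self_eq_ellipticWeylMass_of_mul_conj_eq_one {α : G → ℂ}
    (h : ∀ T ∈ 𝔇.cartanG, ∀ᵐ t : ↥T ∂(𝔇.μT T), α (t : G) * conj (α (t : G)) = 1) :
    𝔇.innerG α α = ∑ T ∈ 𝔇.cartanG, ((weylOrder T : ℂ))⁻¹ * ∫ t : ↥T, ((𝔇.DG (t : G) : ℂ)) ^ 2 ∂(𝔇.μT T) := by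
  unfold EllipticData.innerG
  refine Finset.sum_congr rfl fun T hT => ?_
  congr 1
  refine integral_congr_ae ((h T hT).mono fun t ht => ?_)
  show ((𝔇.DG (t : G) : ℂ)) ^ 2 * α (t : G) * conj (α (t : G)) = ((𝔇.DG (t : G) : ℂ)) ^ 2
  rw [mul_assoc, ht, mul_one]

end GenericDatum

/-! ## §2 Reading the DET pin: `χ_{ψ∘det_G} = ψ ∘ det_Z` on `G^r` -/

section Datum

variable (L : Type) [Field L] [NumberField L] [IsCMField L] (v : HeightOneSpectrum (𝓞 ↥(maximalRealSubfield L)))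

/-- **READING THE DET PIN: `χ_{𝔇.detG ψ}(γ) = ψ(det_Z γ)` for every REGULAR `γ`** at a §12.5 datum on `U(Φ₃)(L⁺_v)` with COMPAT `hμG`, (M1∀) `hM1` and the DET pin
`𝔇.detG ψ = ⟦ψ ∘ det_Z⟧` (★ ST-PIN `exists_stDetFields`).  Proof: on a compact-open `U ∋ γ` on which both `χ := 𝔇.char (𝔇.detG ψ)` (by (M1∀) at the regular `γ`) and `ψ ∘ det_Z`
(open kernel) are constant, `Tr ⟦ψ∘det_Z⟧(𝟙_U)` is `ν(U)·χ(γ)` by (M1∀) and `ν(U)·ψ(det_Z γ)` by ★ `IrrClass.smoothTrace_mk_ofChar`; `ν(U) > 0`.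
[cite: Rogawski1990, §12.2 (1) p. 173; §1.6 p. 5] -/
theorem char_detG_eq_of_pin
    [MeasurableSpace (Gqs L v)] [BorelSpace (Gqs L v)]
    [∀ γ : Gqs L v, MeasurableSpace (Gqs L v ⧸ Subgroup.centralizer ({γ} : Set (Gqs L v)))]
    [MeasurableSpace (Gqs L v ⧸ Subgroup.center (Gqs L v))]
    {H : Type} [Group H] [TopologicalSpace H] [IsTopologicalGroup H] [MeasurableSpace H]
    (νQv : Measure (Gqs L v)) [νQv.IsHaarMeasure]
    (𝔇 : EllipticData (Gqs L v) H)
    (hμG : 𝔇.μG = νQv)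
    (hM1 : ∀ π : IrrClass (Gqs L v), Measurable (𝔇.char π) ∧ LocallyIntegrable (𝔇.char π) 𝔇.μG ∧
      (∀ x ∈ 𝔇.regG, ∀ᶠ y in 𝓝 x, 𝔇.char π y = 𝔇.char π x) ∧
      ∀ φ : Gqs L v → ℂ, IsLocSmooth φ → π.smoothTrace 𝔇.μG φ = ∫ x, φ x * 𝔇.char π x ∂𝔇.μG)
    {ψ : ↥(Subgroup.center (Gqs L v)) →* ℂˣ} (detZ : Gqs L v →* ↥(Subgroup.center (Gqs L v)))
    (hopen : IsOpen (((ψ.comp detZ).ker : Subgroup (Gqs L v)) : Set (Gqs L v)))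
    (hdet : 𝔇.detG ψ = IrrClass.mk (SmoothIrrep.ofChar (ψ.comp detZ) hopen)) :
    ∀ γ ∈ 𝔇.regG, 𝔇.char (𝔇.detG ψ) γ = ((ψ (detZ γ) : ℂˣ) : ℂ) := by
  intro γ hγ
  haveI : NonarchimedeanGroup (Gqs L v) := nonarchimedeanGroup_cmLocal L 3 v
  haveI : TotallyDisconnectedSpace (Gqs L v) := totallyDisconnectedSpace_cmDatum_local L 3 (qsForm L) v
  obtain ⟨-, -, hlc, htr⟩ := hM1 (𝔇.detG ψ)
  -- `ψ ∘ det_Z` is locally constant (open kernel)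
  have hξlc : IsLocallyConstant (fun g : Gqs L v => (((ψ.comp detZ) g : ℂˣ) : ℂ)) := isLocallyConstant_character (ψ.comp detZ) hopen
  -- a compact-open `U ∋ γ` on which both functions are constant
  have hW : ({y : Gqs L v | 𝔇.char (𝔇.detG ψ) y = 𝔇.char (𝔇.detG ψ) γ} ∩
      {y | (((ψ.comp detZ) y : ℂˣ) : ℂ) = (((ψ.comp detZ) γ : ℂˣ) : ℂ)}) ∈ 𝓝 γ :=
    inter_mem (hlc γ hγ) (hξlc.eventually_eq γ)
  obtain ⟨O, hOW, hOo, hγO⟩ := mem_nhds_iff.1 hW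
  obtain ⟨U, hUc, hUo, hγU, hUO⟩ := Literature.Topology.exists_isCompact_isOpen_mem_subset hOo hγO
  have hUW : U ⊆ _ := hUO.trans hOW
  have hφ : IsLocSmooth (U.indicator fun _ => (1 : ℂ)) := isLocSmooth_indicator hUo hUc.isClosed hUc
  -- `Tr ⟦ψ∘det_Z⟧(𝟙_U)` two ways
  have h1 : (𝔇.detG ψ).smoothTrace νQv (U.indicator fun _ => (1 : ℂ)) = (νQv.real U : ℂ) * 𝔇.char (𝔇.detG ψ) γ := by
    rw [← hμG, htr _ hφ, hμG]
    exact F0P3cStCharTSCasselmanCap.integral_indicator_mul_eq_of_eqOn νQv hUo.measurableSet _ γ fun g hg => (hUW hg).1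
  have h2 : (𝔇.detG ψ).smoothTrace νQv (U.indicator fun _ => (1 : ℂ)) = (νQv.real U : ℂ) * (((ψ.comp detZ) γ : ℂˣ) : ℂ) := by
    obtain ⟨K, hK⟩ := exists_isLevel (G := Gqs L v) (f := U.indicator fun _ => (1 : ℂ)) ⟨hφ.1, hφ.2⟩
    rw [hdet, IrrClass.smoothTrace_mk_ofChar νQv hopen hφ.2 hK, charDist_def]
    have hcomm : (fun h : Gqs L v => (((ψ.comp detZ) h : ℂˣ) : ℂ) * U.indicator (fun _ => (1 : ℂ)) h) =
        fun h => U.indicator (fun _ => (1 : ℂ)) h * (((ψ.comp detZ) h : ℂˣ) : ℂ) := by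
      funext h; rw [mul_comm]
    rw [hcomm]
    exact F0P3cStCharTSCasselmanCap.integral_indicator_mul_eq_of_eqOn νQv hUo.measurableSet _ γ fun g hg => (hUW hg).2
  have hpos : (νQv.real U : ℂ) ≠ 0 := by
    have hp : 0 < νQv.real U := ENNReal.toReal_pos (hUo.measure_pos νQv ⟨γ, hγU⟩).ne' hUc.measure_lt_top.ne
    exact_mod_cast hp.ne'
  have := h1.symm.trans h2
  exact mul_left_cancel₀ hpos this

/-! ## §3 K1 at `ψ∘det_G`: `conj(ψ∘det_Z) · fG` is a pseudo-coefficient of `𝔇.detG ψ` -/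

/-- **K1 AT `ψ∘det_G`: `f_det := conj(ψ∘det_Z) · fG` IS A PSEUDO-COEFFICIENT OF `𝔇.detG ψ`** at every §12.5 datum on `U(Φ₃)(L⁺_v)` (`v` non-split) with the rung-0 pins
`hμG horb hreg hE hM1` VERBATIM as in ★ E2-5b `isPseudoCoeff_scCoeff` and the DET pin, for ANY `fG` that is locally constant with compact support and has canonical orbital
integral `1` at the regular classes with COMPACT centraliser and `0` at those with NON-compact centraliser (clauses of (G3) `exists_epFunction_G`).
Clause 1: §1∕★ `isLocallyConstant_character`; clause 2 (off `G^e`): `hE` + ★ `isCompact_centralizer_iff_not_mem_hyperbolicSet` ⇒ non-compact centraliser ⇒ `Φ = 0`;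
clause 3 (on `G^e`): compact centraliser ⇒ `Φ(γ, fG) = 1`, §1 and §2. [cite: Rogawski1990, §12.6 p. 187; §12.2 (1) p. 173] [cite: Kottwitz1988, §2 Theorem 2] -/
theorem isPseudoCoeff_detG_of_ep
    (hns : ∀ w : PlacesOver L v, IsCMField.complexConj L • w.1 = w.1)
    [MeasurableSpace (Gqs L v)] [BorelSpace (Gqs L v)]
    [∀ γ : Gqs L v, MeasurableSpace (Gqs L v ⧸ Subgroup.centralizer ({γ} : Set (Gqs L v)))]
    [MeasurableSpace (Gqs L v ⧸ Subgroup.center (Gqs L v))]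
    {H : Type} [Group H] [TopologicalSpace H] [IsTopologicalGroup H] [MeasurableSpace H]
    (νQv : Measure (Gqs L v)) [νQv.IsHaarMeasure]
    (mQv : OrbitalMeasureFamily (Gqs L v))
    (𝔇 : EllipticData (Gqs L v) H)
    (hμG : 𝔇.μG = νQv) (horb : 𝔇.orb = mQv)
    (hreg : ∀ γ : Gqs L v, γ ∈ 𝔇.regG ↔ IsRegularElt (γ.val : GL (Fin 3) (UnitaryGroup.LocalRing L v)))
    (hE : ∀ γ : Gqs L v, γ ∈ 𝔇.ellG ↔ IsRegularElt (γ.val : GL (Fin 3) (UnitaryGroup.LocalRing L v)) ∧ γ ∉ hyperbolicSet L v)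
    (hM1 : ∀ π : IrrClass (Gqs L v), Measurable (𝔇.char π) ∧ LocallyIntegrable (𝔇.char π) 𝔇.μG ∧
      (∀ x ∈ 𝔇.regG, ∀ᶠ y in 𝓝 x, 𝔇.char π y = 𝔇.char π x) ∧
      ∀ φ : Gqs L v → ℂ, IsLocSmooth φ → π.smoothTrace 𝔇.μG φ = ∫ x, φ x * 𝔇.char π x ∂𝔇.μG)
    {ψ : ↥(Subgroup.center (Gqs L v)) →* ℂˣ} (detZ : Gqs L v →* ↥(Subgroup.center (Gqs L v)))
    (hopen : IsOpen (((ψ.comp detZ).ker : Subgroup (Gqs L v)) : Set (Gqs L v)))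
    (hdet : 𝔇.detG ψ = IrrClass.mk (SmoothIrrep.ofChar (ψ.comp detZ) hopen))
    {fG : Gqs L v → ℂ} (hfG : IsLocSmooth fG)
    (h1 : ∀ γ : Gqs L v, IsRegularElt (γ.val : GL (Fin 3) (UnitaryGroup.LocalRing L v)) →
      IsCompact ((Subgroup.centralizer ({γ} : Set (Gqs L v))) : Set (Gqs L v)) → classOrbitalIntegral mQv fG (ConjClasses.mk γ) = 1)
    (h0 : ∀ γ : Gqs L v, IsRegularElt (γ.val : GL (Fin 3) (UnitaryGroup.LocalRing L v)) →
      ¬ IsCompact ((Subgroup.centralizer ({γ} : Set (Gqs L v))) : Set (Gqs L v)) → classOrbitalIntegral mQv fG (ConjClasses.mk γ) = 0) :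
    𝔇.IsPseudoCoeff (𝔇.detG ψ) (fun g => conj (((ψ (detZ g)) : ℂˣ) : ℂ) * fG g) := by
  have hclass : ∀ x g : Gqs L v, conj (((ψ (detZ (x * g * x⁻¹))) : ℂˣ) : ℂ) = conj (((ψ (detZ g)) : ℂˣ) : ℂ) :=
    conj_centerChar_detZ_conj_eq detZ ψ
  refine ⟨?_, ?_, ?_⟩
  · -- clause 1: `conj(ψ∘det_Z) · fG ∈ 𝒮(G)`
    have hξlc : IsLocallyConstant (fun g : Gqs L v => conj ((((ψ.comp detZ) g : ℂˣ) : ℂ))) :=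
      (isLocallyConstant_character (ψ.comp detZ) hopen).comp _
    exact ⟨hξlc.comp₂ hfG.1 (· * ·), hfG.2.mul_left⟩
  · -- clause 2: off `G^e` the centraliser is NOT compact
    intro γ hγ
    obtain ⟨hγr, hγe⟩ := hγ
    have hγreg : IsRegularElt (γ.val : GL (Fin 3) (UnitaryGroup.LocalRing L v)) := (hreg γ).1 hγr
    have hγhyp : γ ∈ hyperbolicSet L v := by
      by_contra h
      exact hγe ((hE γ).2 ⟨hγreg, h⟩)
    have hnc : ¬ IsCompact ((Subgroup.centralizer ({γ} : Set (Gqs L v))) : Set (Gqs L v)) := fun h =>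
      (F0P3cStCharTSEllCartanCompact.isCompact_centralizer_iff_not_mem_hyperbolicSet L v hns hγreg).1 h hγhyp
    show classOrbitalIntegral 𝔇.orb _ (ConjClasses.mk γ) = 0
    rw [horb, classOrbitalIntegral_mul_of_forall_conj_eq mQv _ fG hclass γ, h0 γ hγreg hnc, mul_zero]
  · -- clause 3: on `G^e` the centraliser is compact, `Φ(γ, fG) = 1`, and `χ_{detG ψ}(γ) = ψ(det_Z γ)`
    intro γ hγ
    obtain ⟨hγreg, hγhyp⟩ := (hE γ).1 hγ
    have hc : IsCompact ((Subgroup.centralizer ({γ} : Set (Gqs L v))) : Set (Gqs L v)) :=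
      (F0P3cStCharTSEllCartanCompact.isCompact_centralizer_iff_not_mem_hyperbolicSet L v hns hγreg).2 hγhyp
    show classOrbitalIntegral 𝔇.orb _ (ConjClasses.mk γ) = _
    rw [horb, classOrbitalIntegral_mul_of_forall_conj_eq mQv _ fG hclass γ, h1 γ hγreg hc, mul_one,
      char_detG_eq_of_pin L v νQv 𝔇 hμG hM1 detZ hopen hdet γ ((hreg γ).2 hγreg)]

/-! ## §4 K1 at `St_G(ψ)`: `−conj(ψ∘det_Z) · fG` is a pseudo-coefficient of `𝔇.stG ψ` -/

/-- **K1 AT `St_G(ψ)`: `f_St := −conj(ψ∘det_Z) · fG` IS A PSEUDO-COEFFICIENT OF `𝔇.stG ψ`**, given additionally the opposite-character relation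
`hOpp : χ_{St_G(ψ)} = −χ_{ψ∘det_G}` on `G^e` — the conclusion of ★ OPP-23 `F0P3cStCharTSOpp23.charOpposite_of_PS2` at the kind-2 pair `(ψ∘det_G, St_G(ψ))` [Rogawski1990 p. 188
«observe that `χ_π = −χ_{π′}` on `G^e`»], which the rung-0 pen discharges from ★ OPP-23 with the (DET)∕(ST-L2) sockets.  Clauses: `−(§3)`, `Φ(γ, −f) = −Φ(γ, f)`.
[cite: Rogawski1990, §12.6 p. 187; Prop. 12.6.1 (c) p. 188; §12.2 (1) p. 173] [cite: Kottwitz1988, §2 Theorem 2] -/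
theorem isPseudoCoeff_stG_of_ep
    (hns : ∀ w : PlacesOver L v, IsCMField.complexConj L • w.1 = w.1)
    [MeasurableSpace (Gqs L v)] [BorelSpace (Gqs L v)]
    [∀ γ : Gqs L v, MeasurableSpace (Gqs L v ⧸ Subgroup.centralizer ({γ} : Set (Gqs L v)))]
    [MeasurableSpace (Gqs L v ⧸ Subgroup.center (Gqs L v))]
    {H : Type} [Group H] [TopologicalSpace H] [IsTopologicalGroup H] [MeasurableSpace H]
    (νQv : Measure (Gqs L v)) [νQv.IsHaarMeasure]
    (mQv : OrbitalMeasureFamily (Gqs L v))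
    (𝔇 : EllipticData (Gqs L v) H)
    (hμG : 𝔇.μG = νQv) (horb : 𝔇.orb = mQv)
    (hreg : ∀ γ : Gqs L v, γ ∈ 𝔇.regG ↔ IsRegularElt (γ.val : GL (Fin 3) (UnitaryGroup.LocalRing L v)))
    (hE : ∀ γ : Gqs L v, γ ∈ 𝔇.ellG ↔ IsRegularElt (γ.val : GL (Fin 3) (UnitaryGroup.LocalRing L v)) ∧ γ ∉ hyperbolicSet L v)
    (hM1 : ∀ π : IrrClass (Gqs L v), Measurable (𝔇.char π) ∧ LocallyIntegrable (𝔇.char π) 𝔇.μG ∧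
      (∀ x ∈ 𝔇.regG, ∀ᶠ y in 𝓝 x, 𝔇.char π y = 𝔇.char π x) ∧
      ∀ φ : Gqs L v → ℂ, IsLocSmooth φ → π.smoothTrace 𝔇.μG φ = ∫ x, φ x * 𝔇.char π x ∂𝔇.μG)
    {ψ : ↥(Subgroup.center (Gqs L v)) →* ℂˣ} (detZ : Gqs L v →* ↥(Subgroup.center (Gqs L v)))
    (hopen : IsOpen (((ψ.comp detZ).ker : Subgroup (Gqs L v)) : Set (Gqs L v)))
    (hdet : 𝔇.detG ψ = IrrClass.mk (SmoothIrrep.ofChar (ψ.comp detZ) hopen))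
    (hOpp : ∀ γ ∈ 𝔇.ellG, 𝔇.char (𝔇.stG ψ) γ = -𝔇.char (𝔇.detG ψ) γ)
    {fG : Gqs L v → ℂ} (hfG : IsLocSmooth fG)
    (h1 : ∀ γ : Gqs L v, IsRegularElt (γ.val : GL (Fin 3) (UnitaryGroup.LocalRing L v)) →
      IsCompact ((Subgroup.centralizer ({γ} : Set (Gqs L v))) : Set (Gqs L v)) → classOrbitalIntegral mQv fG (ConjClasses.mk γ) = 1)
    (h0 : ∀ γ : Gqs L v, IsRegularElt (γ.val : GL (Fin 3) (UnitaryGroup.LocalRing L v)) →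
      ¬ IsCompact ((Subgroup.centralizer ({γ} : Set (Gqs L v))) : Set (Gqs L v)) → classOrbitalIntegral mQv fG (ConjClasses.mk γ) = 0) :
    𝔇.IsPseudoCoeff (𝔇.stG ψ) (fun g => -(conj (((ψ (detZ g)) : ℂˣ) : ℂ) * fG g)) := by
  obtain ⟨hS, hoff, hon⟩ := isPseudoCoeff_detG_of_ep L v hns νQv mQv 𝔇 hμG horb hreg hE hM1 detZ hopen hdet hfG h1 h0
  have hneg : (fun g => -(conj (((ψ (detZ g)) : ℂˣ) : ℂ) * fG g)) = -(fun g => conj (((ψ (detZ g)) : ℂˣ) : ℂ) * fG g) := rfl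
  refine ⟨?_, fun γ hγ => ?_, fun γ hγ => ?_⟩
  · rw [hneg]; exact Submodule.neg_mem _ hS
  · show classOrbitalIntegral 𝔇.orb _ (ConjClasses.mk γ) = 0
    rw [hneg, classOrbitalIntegral_eq, orbitalIntegral_neg, ← classOrbitalIntegral_eq]
    have := hoff γ hγ
    rw [EllipticData.orbInt] at this
    rw [this, neg_zero]
  · show classOrbitalIntegral 𝔇.orb _ (ConjClasses.mk γ) = _
    rw [hneg, classOrbitalIntegral_eq, orbitalIntegral_neg, ← classOrbitalIntegral_eq]
    have := hon γ hγ
    rw [EllipticData.orbInt] at this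
    rw [this, hOpp γ hγ, map_neg]

/-! ## §5 Values at `1`; POS-ONE at `St_G(ψ)` -/

omit [IsCMField L] in
/-- `f_det(1) = fG(1)` (`ψ(det_Z 1) = 1`). [cite: Rogawski1990, §12.6 p. 194] -/
theorem epDet_apply_one {G : Type*} [Group G] (ψ : ↥(Subgroup.center G) →* ℂˣ) (detZ : G →* ↥(Subgroup.center G)) (fG : G → ℂ) :
    (fun g => conj (((ψ (detZ g)) : ℂˣ) : ℂ) * fG g) 1 = fG 1 := by
  simp only [map_one, Units.val_one, map_one, one_mul]

omit [IsCMField L] in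
/-- `f_St(1) = −fG(1)`. [cite: Rogawski1990, §12.6 p. 194] -/
theorem epSt_apply_one {G : Type*} [Group G] (ψ : ↥(Subgroup.center G) →* ℂˣ) (detZ : G →* ↥(Subgroup.center G)) (fG : G → ℂ) :
    (fun g => -(conj (((ψ (detZ g)) : ℂˣ) : ℂ) * fG g)) 1 = -fG 1 := by
  simp only [map_one, Units.val_one, map_one, one_mul]

omit [IsCMField L] in
/-- **POS-ONE AT `St_G(ψ)`: `f_St(1)` is a POSITIVE REAL** when `fG(1)` is a NEGATIVE real (Kottwitz's `f_EP(1) = ν(K₀)⁻¹ + ν(K₁)⁻¹ − ν(I)⁻¹ < 0`, ★ (G7)) — print's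
«`f_π(1) = d(π)`», «formal degrees are positive» at `π = St_G(ψ)`, here from Serre's sign of the Euler–Poincaré measure.
[cite: Rogawski1990, §12.6 pp. 194–195] [cite: Serre1971, §3.3] [cite: Kottwitz1988, §2 Theorem 2] -/
theorem epSt_one_re_pos_im_zero {G : Type*} [Group G] (ψ : ↥(Subgroup.center G) →* ℂˣ) (detZ : G →* ↥(Subgroup.center G)) {fG : G → ℂ}
    (him : (fG 1).im = 0) (hre : (fG 1).re < 0) :
    0 < ((fun g => -(conj (((ψ (detZ g)) : ℂˣ) : ℂ) * fG g)) 1).re ∧ ((fun g => -(conj (((ψ (detZ g)) : ℂˣ) : ℂ) * fG g)) 1).im = 0 := by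
  rw [epSt_apply_one]
  simp only [Complex.neg_re, Complex.neg_im, him, neg_zero, Left.neg_pos_iff, hre, and_self]


end Datum

end Summit.HodgeConjecture.HodgeConjecture.Cruxes.H413.F0P3cStCharTSEPPseudoCoeffSt

end
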